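import Summits.CriticalPhenomena.CardyFormulaZ2.Theorems.CardySusyWardParafermionFamiliesToSLESixFluxPropagationLattice
import Summits.CriticalPhenomena.CardyFormulaZ2.Theorems.CardySusyWardParafermionFamiliesToSLESixHalfCRVertexRelationPairing

/-!
# The concrete anchor family (skeleton r4 of line `strip-anchored-vertex-normalisation`,
# crux stmt-CriticalPhenomena-10814), IX: the cone inequalities of the boundary first moment

Helper file of the stub `stub_anchorMoment_of_IP` (assembly of the boundary first moment of the concrete
anchor data `anchorData δ`): the PURE COMPLEX ARITHMETIC of the wall terms.  The moment argument bounds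
`‖W − 2(1−i)·M‖` (`W = wallPlainSum`, `M = momentSum`) from below by the linear functional
`Φ(Z) = (Re Z + Im Z)/2 ≤ ‖Z‖`; on a wall corner `(p, k)` with corner observable `G = u · P` (`u` the
deterministic touch phase `sixthPhase n` of its side and type, `P ≥ 0` a touch/swing probability) and
lattice position `ẑ = ẑ_p`, the contribution is
`ψ = (Re G + Im G)/2 − 2·Im(conj ẑ · coeff i k · G)` (`psi_eq`).  This file proves, family by family
(free side `k = 1`, lower-right wired side `k = 2`, upper-left wired side `k = 0`, lower-left wired side
`k = 3`; horizontal / vertical medial vertex), the explicit lower bounds on `ψ` in terms of `P` and the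
coordinates of `ẑ` (`cone_*`): nonnegativity on the regular corners, the mass term `P · (Re ẑ + Im ẑ)` on the
free side, the two exact linear forms of the upper-left side whose SUM over a common face is nonnegative
(`stub_anchorMomentCone`), and the crude bound `ψ ≥ −(4R + 1)` for `‖G‖ ≤ 1`, `‖ẑ‖ ≤ R` (`psi_ge_neg`;
`‖coeff i k‖ = 1` is the landed `S6.norm_coeff_I`).  The only
trigonometric input is the table `sixthPhase (-1) = (√3 + i)/2`, `sixthPhase (-2) = (1 + i√3)/2`,
`sixthPhase (-3) = i`, `sixthPhase (-4) = (−1 + i√3)/2`.  All elementary. [folklore]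
-/

noncomputable section

namespace Summit.CriticalPhenomena.CardyFormulaZ2.Theorems.ParafermionFamiliesToSLESix.StripAnchored

open Complex
open Literature.Barriers.CriticalPhenomena.HalfCRGreen (coeff coeff_zero coeff_one coeff_two coeff_three)
open S2 (sixthPhase sixthPhase_add sixthPhase_eq)

namespace AnchorCone

/-! ## The phase table -/

/-- `sixthPhase (-1) = e^{iπ/6} = (√3 + i)/2`. [folklore] -/
theorem sixthPhase_neg_one : sixthPhase (-1) = ⟨Real.sqrt 3 / 2, 1 / 2⟩ := by
  have e : Real.pi / 6 * ((-1 : ℤ) : ℝ) = -(Real.pi / 6) := by push_cast; ring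
  rw [sixthPhase_eq, e, Real.cos_neg, Real.sin_neg, Real.cos_pi_div_six, Real.sin_pi_div_six]
  apply Complex.ext <;> simp

/-- `sixthPhase (-2) = e^{iπ/3} = (1 + i√3)/2`. [folklore] -/
theorem sixthPhase_neg_two : sixthPhase (-2) = ⟨1 / 2, Real.sqrt 3 / 2⟩ := by
  have e : Real.pi / 6 * ((-2 : ℤ) : ℝ) = -(Real.pi / 3) := by push_cast; ring
  rw [sixthPhase_eq, e, Real.cos_neg, Real.sin_neg, Real.cos_pi_div_three, Real.sin_pi_div_three]
  apply Complex.ext <;> simp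

/-- `sixthPhase (-3) = e^{iπ/2} = i`. [folklore] -/
theorem sixthPhase_neg_three : sixthPhase (-3) = I := by
  have e : Real.pi / 6 * ((-3 : ℤ) : ℝ) = -(Real.pi / 2) := by push_cast; ring
  rw [sixthPhase_eq, e, Real.cos_neg, Real.sin_neg, Real.cos_pi_div_two, Real.sin_pi_div_two]
  apply Complex.ext <;> simp

/-- `sixthPhase (-4) = e^{2iπ/3} = (−1 + i√3)/2` (`= sixthPhase (-2)²`, `√3² = 3`). [folklore] -/
theorem sixthPhase_neg_four : sixthPhase (-4) = ⟨-(1 / 2), Real.sqrt 3 / 2⟩ := by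
  have h3 : Real.sqrt 3 * Real.sqrt 3 = 3 := Real.mul_self_sqrt (by norm_num)
  rw [show (-4 : ℤ) = -2 + -2 by norm_num, sixthPhase_add, sixthPhase_neg_two]
  apply Complex.ext <;> simp <;> nlinarith [h3]

/-- `1 ≤ √3 ≤ 2` and `√3 · √3 = 3`. [folklore] -/
theorem sqrt_three_bounds : 1 ≤ Real.sqrt 3 ∧ Real.sqrt 3 ≤ 2 ∧ Real.sqrt 3 * Real.sqrt 3 = 3 := by
  refine ⟨Real.one_le_sqrt.2 (by norm_num), ?_, Real.mul_self_sqrt (by norm_num)⟩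
  rw [show (2:ℝ) = Real.sqrt 4 by rw [show (4:ℝ) = 2 ^ 2 by norm_num, Real.sqrt_sq (by norm_num)]]
  exact Real.sqrt_le_sqrt (by norm_num)

/-! ## The functional `Φ(Z) = (Re Z + Im Z)/2` -/

/-- `(Re Z + Im Z)/2 ≤ ‖Z‖`. [folklore] -/
theorem re_add_im_div_two_le_norm (Z : ℂ) : (Z.re + Z.im) / 2 ≤ ‖Z‖ := by
  have h1 := Complex.re_le_norm Z
  have h2 := Complex.im_le_norm Z
  linarith

/-- `−‖Z‖ ≤ (Re Z + Im Z)/2`. [folklore] -/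
theorem neg_norm_le_re_add_im_div_two (Z : ℂ) : -‖Z‖ ≤ (Z.re + Z.im) / 2 := by
  have h1 := Complex.abs_re_le_norm Z
  have h2 := Complex.abs_im_le_norm Z
  rw [abs_le] at h1 h2
  linarith [h1.1, h2.1]

/-- The wall-corner contribution to `Φ(W − 2(1−i)M)`: `Φ(G − 2(1−i)w) = (Re G + Im G)/2 − 2 Im w`.
[folklore] -/
theorem psi_eq (G w : ℂ) :
    ((G - 2 * (1 - I) * w).re + (G - 2 * (1 - I) * w).im) / 2 = (G.re + G.im) / 2 - 2 * w.im := by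
  simp only [sub_re, sub_im, mul_re, mul_im, one_re, one_im, I_re, I_im, re_ofNat, im_ofNat]
  ring

/-- **Crude bound.** For `‖G‖ ≤ 1`, `‖ẑ‖ ≤ R`: `−(4R + 1) ≤ (Re G + Im G)/2 − 2 Im(conj ẑ · coeff i k · G)`.
[folklore] -/
theorem psi_ge_neg {G z : ℂ} {R : ℝ} (hG : ‖G‖ ≤ 1) (hz : ‖z‖ ≤ R) (k : Fin 4) :
    -(4 * R + 1) ≤ (G.re + G.im) / 2 - 2 * ((starRingEnd ℂ) z * coeff I k * G).im := by
  have hR : 0 ≤ R := (norm_nonneg z).trans hz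
  have h1 : -1 ≤ (G.re + G.im) / 2 := by
    have := neg_norm_le_re_add_im_div_two G
    linarith
  have h2 : ((starRingEnd ℂ) z * coeff I k * G).im ≤ R := by
    refine (Complex.im_le_norm _).trans ?_
    rw [norm_mul, norm_mul, S6.norm_coeff_I, Complex.norm_conj, mul_one]
    calc ‖z‖ * ‖G‖ ≤ R * 1 := mul_le_mul hz hG (norm_nonneg _) hR
      _ = R := mul_one R
  linarith

/-! ## The eight regular families

Throughout `G = sixthPhase n · P` is the corner observable (`P ≥ 0`), `z = ẑ_p` the lattice position of the
medial vertex `p` (mesh `1`), `k` the corner index (`coeff i k`), and the bound is on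
`ψ = (Re G + Im G)/2 − 2 Im(conj z · coeff i k · G)`. -/

/-- **Free side, horizontal vertex** (`k = 1`, phase `sixthPhase (-1)`): for `Re z ≥ 0`,
`P · (Re z + Im z) ≤ ψ` (the MASS term). [folklore] -/
theorem cone_free_zero {G z : ℂ} {P : ℝ} (hP : 0 ≤ P) (hG : G = sixthPhase (-1) * (P : ℂ))
    (hre : 0 ≤ z.re) :
    P * (z.re + z.im) ≤ (G.re + G.im) / 2 - 2 * ((starRingEnd ℂ) z * coeff I 1 * G).im := by
  obtain ⟨h1, h2, h3⟩ := sqrt_three_bounds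
  rw [hG, sixthPhase_neg_one]
  simp only [mul_re, mul_im, ofReal_re, ofReal_im, conj_re, conj_im, coeff_one, neg_re, neg_im, I_re, I_im]
  nlinarith [mul_nonneg hP hre, mul_nonneg (mul_nonneg hP hre) (sub_nonneg.2 h1)]

/-- **Free side, vertical vertex** (`k = 1`, phase `sixthPhase (-3) = i`): for `Im z ≥ 0`, `0 ≤ ψ`.
[folklore] -/
theorem cone_free_one {G z : ℂ} {P : ℝ} (hP : 0 ≤ P) (hG : G = sixthPhase (-3) * (P : ℂ))
    (him : 0 ≤ z.im) :
    0 ≤ (G.re + G.im) / 2 - 2 * ((starRingEnd ℂ) z * coeff I 1 * G).im := by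
  rw [hG, sixthPhase_neg_three]
  simp only [mul_re, mul_im, ofReal_re, ofReal_im, conj_re, conj_im, coeff_one, neg_re, neg_im, I_re, I_im]
  nlinarith [mul_nonneg hP him]

/-- **Lower-right wired side, horizontal vertex** (`k = 2`, phase `sixthPhase 0 = 1`): for `Im z ≤ 0`,
`0 ≤ ψ`. [folklore] -/
theorem cone_LR_zero {G z : ℂ} {P : ℝ} (hP : 0 ≤ P) (hG : G = sixthPhase 0 * (P : ℂ))
    (him : z.im ≤ 0) :
    0 ≤ (G.re + G.im) / 2 - 2 * ((starRingEnd ℂ) z * coeff I 2 * G).im := by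
  rw [hG, S2.sixthPhase_zero]
  simp only [mul_re, mul_im, ofReal_re, ofReal_im, conj_re, conj_im, coeff_two, neg_re, neg_im, one_re,
    one_im, one_mul]
  nlinarith [mul_nonneg hP (neg_nonneg.2 him)]

/-- **Lower-right wired side, vertical vertex** (`k = 2`, phase `sixthPhase (-2)`): for `Re z ≥ 0 ≥ Im z`,
`0 ≤ ψ`. [folklore] -/
theorem cone_LR_one {G z : ℂ} {P : ℝ} (hP : 0 ≤ P) (hG : G = sixthPhase (-2) * (P : ℂ))
    (hre : 0 ≤ z.re) (him : z.im ≤ 0) :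
    0 ≤ (G.re + G.im) / 2 - 2 * ((starRingEnd ℂ) z * coeff I 2 * G).im := by
  obtain ⟨h1, h2, h3⟩ := sqrt_three_bounds
  rw [hG, sixthPhase_neg_two]
  simp only [mul_re, mul_im, ofReal_re, ofReal_im, conj_re, conj_im, coeff_two, neg_re, neg_im, one_re,
    one_im]
  nlinarith [mul_nonneg hP hre, mul_nonneg (mul_nonneg hP hre) (sub_nonneg.2 h1),
    mul_nonneg hP (neg_nonneg.2 him)]

/-- **Upper-left wired side, horizontal vertex** (`k = 0`, phase `sixthPhase (-2)`): the exact linear form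
`P · (Im z − √3 Re z) ≤ ψ`. [folklore] -/
theorem cone_UL_zero {G z : ℂ} {P : ℝ} (hP : 0 ≤ P) (hG : G = sixthPhase (-2) * (P : ℂ)) :
    P * (z.im - Real.sqrt 3 * z.re) ≤ (G.re + G.im) / 2 - 2 * ((starRingEnd ℂ) z * coeff I 0 * G).im := by
  obtain ⟨h1, h2, h3⟩ := sqrt_three_bounds
  rw [hG, sixthPhase_neg_two]
  simp only [mul_re, mul_im, ofReal_re, ofReal_im, conj_re, conj_im, coeff_zero, one_re, one_im]
  nlinarith

/-- **Upper-left wired side, vertical vertex** (`k = 0`, phase `sixthPhase (-4)`): the exact linear form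
`−P · (√3 Re z + Im z) ≤ ψ`. [folklore] -/
theorem cone_UL_one {G z : ℂ} {P : ℝ} (hP : 0 ≤ P) (hG : G = sixthPhase (-4) * (P : ℂ)) :
    -(P * (Real.sqrt 3 * z.re + z.im)) ≤ (G.re + G.im) / 2 - 2 * ((starRingEnd ℂ) z * coeff I 0 * G).im := by
  obtain ⟨h1, h2, h3⟩ := sqrt_three_bounds
  rw [hG, sixthPhase_neg_four]
  simp only [mul_re, mul_im, ofReal_re, ofReal_im, conj_re, conj_im, coeff_zero, one_re, one_im]
  nlinarith

/-- **Lower-left wired side, horizontal vertex** (`k = 3`, phase `sixthPhase (-3) = i`): for `Im z ≤ 0`,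
`0 ≤ ψ`. [folklore] -/
theorem cone_LL_zero {G z : ℂ} {P : ℝ} (hP : 0 ≤ P) (hG : G = sixthPhase (-3) * (P : ℂ))
    (him : z.im ≤ 0) :
    0 ≤ (G.re + G.im) / 2 - 2 * ((starRingEnd ℂ) z * coeff I 3 * G).im := by
  rw [hG, sixthPhase_neg_three]
  simp only [mul_re, mul_im, ofReal_re, ofReal_im, conj_re, conj_im, coeff_three, I_re, I_im]
  nlinarith [mul_nonneg hP (neg_nonneg.2 him)]

/-- **Lower-left wired side, vertical vertex** (`k = 3`, phase `sixthPhase (-1)`): for `Re z, Im z ≤ 0`,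
`0 ≤ ψ`. [folklore] -/
theorem cone_LL_one {G z : ℂ} {P : ℝ} (hP : 0 ≤ P) (hG : G = sixthPhase (-1) * (P : ℂ))
    (hre : z.re ≤ 0) (him : z.im ≤ 0) :
    0 ≤ (G.re + G.im) / 2 - 2 * ((starRingEnd ℂ) z * coeff I 3 * G).im := by
  obtain ⟨h1, h2, h3⟩ := sqrt_three_bounds
  rw [hG, sixthPhase_neg_one]
  simp only [mul_re, mul_im, ofReal_re, ofReal_im, conj_re, conj_im, coeff_three, I_re, I_im]
  nlinarith [mul_nonneg hP (neg_nonneg.2 hre), mul_nonneg (mul_nonneg hP (neg_nonneg.2 hre)) (sub_nonneg.2 h1),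
    mul_nonneg hP (neg_nonneg.2 him)]

/-! ## The upper-left pairing and the nonnegativity of the horizontal upper-left form -/

/-- The horizontal upper-left form is nonnegative left of the diagonal: for `Re z ≤ 0 ≤ Im z`,
`0 ≤ P · (Im z − √3 Re z)`. [folklore] -/
theorem UL_zero_nonneg {P a b : ℝ} (hP : 0 ≤ P) (ha : a ≤ 0) (hb : 0 ≤ b) :
    0 ≤ P * (b - Real.sqrt 3 * a) := by
  obtain ⟨h1, h2, h3⟩ := sqrt_three_bounds
  exact mul_nonneg hP (by nlinarith)

end AnchorCone

open AnchorCone in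
/-- **Registered helper `stub_anchorMomentCone`** (of the stub `stub_anchorMoment_of_IP`, line
`strip-anchored-vertex-normalisation`, skeleton r4): the UPPER-LEFT PAIRING.  For a face `F` of the
upper-left wired side with `F₀ ≤ -1` and swing probability `P ≥ 0`, the sum of the two exact linear forms of
its corners — the horizontal one at `p = (F, 0)` (`ẑ = (F₀ + ½) + i F₁`, form `P (F₁ − √3 (F₀ + ½))`) and the
vertical one at `p = (F + e₀, 1)` (`ẑ = (F₀ + 1) + i (F₁ + ½)`, form `−P (√3 (F₀ + 1) + F₁ + ½)`) — is
nonnegative (`= P (−2√3 F₀ − 3√3/2 − 1/2) ≥ P (√3/2 − 1/2)`). [folklore] -/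
theorem stub_anchorMomentCone : ∀ (P F₀ F₁ : ℝ), 0 ≤ P → F₀ ≤ -1 → 0 ≤ P * (F₁ - Real.sqrt 3 * (F₀ + 1 / 2)) + -(P * (Real.sqrt 3 * (F₀ + 1) + (F₁ + 1 / 2))) := by
  intro P F₀ F₁ hP hF
  obtain ⟨h1, h2, h3⟩ := sqrt_three_bounds
  have : 0 ≤ -2 * Real.sqrt 3 * F₀ - 3 * Real.sqrt 3 / 2 - 1 / 2 := by nlinarith
  nlinarith [mul_nonneg hP this]

end Summit.CriticalPhenomena.CardyFormulaZ2.Theorems.ParafermionFamiliesToSLESix.StripAnchored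

end
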